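import Summits.RiemannHypothesis.RiemannHypothesis.Theses.NymanBeurling
import Summits.RiemannHypothesis.RiemannHypothesis.Theorems.NymanBeurlingNbThesis
import Literature.NumberTheory.LFunctions.NymanBeurlingDirichlet

/-!
# Route NymanBeurling — zero localisation from a single Báez-Duarte distance

Route `RiemannHypothesis/NymanBeurling`, target `NbThesis` (stmt-RiemannHypothesis-0392): for every
`ε > 0` some Dirichlet polynomial `A(s) = Σ_{k<N} a_k (k+1)^{-s}` has
`I(N,a) := ∫⁻ |1 - ζ(1/2+it) A(1/2+it)|² dt/(1/4+t²) < ε`.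

The elementary half of the criterion (`I → 0 ⇒ RH`) is proved in the tree by a contour argument
(`Literature.NumberTheory.LFunctions.riemannHypothesis_of_dirichlet_approx`). This file makes that
half QUANTITATIVE and UNCONDITIONAL, in the item's exact integrand:

* `nb_lintegral_kernel_sq_le` — the Cauchy kernel of the contour argument has critical-line mass
  `≤ π ‖ρ+1‖² / (Re ρ - 1/2)²`.
* `nbIntegrand_floor_of_zero` — **every zero `ρ` of `ζ` with `Re ρ > 1/2` puts an explicit floor
  under every distance**: for all `N`, `a`,
  `4π (Re ρ - 1/2)² ‖ρ-1‖² / (‖ρ‖⁴ ‖ρ+1‖²) ≤ I(N,a)`.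
  (Nikolski-type localisation: the value `1 - ζA = 1` at `ρ` is controlled by the `L²` mass on the
  line through the reproducing/Cauchy kernel at `ρ`.)
* `nb_zero_constraint_of_witness` — contrapositive, the CERTIFICATE reading: one computed value
  `I(N,a) < η` confines all zeros off the critical line to the explicit region
  `{ρ : 4π (Re ρ - 1/2)² ‖ρ-1‖² / (‖ρ‖⁴ ‖ρ+1‖²) < η}` (and its mirror image under `s ↦ 1 - s`);
  `nb_zero_free_parabola_of_witness` — the same as a parabolic zero-free region: zeros with
  `|Im ρ| ≥ 1` off the line obey `π (Re ρ - 1/2)² < 5 η (Im ρ)⁴`.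
* `nb_uniform_floor_of_not_riemannHypothesis`, `not_nbThesis_iff_uniform_floor` — failure of RH is
  the same as a uniform positive floor under all distances (kill criterion (i) of the route, made
  two-sided), and `nbThesis_iff_iInf_eq_zero` — `NbThesis ↔ ⨅_{N,a} I(N,a) = 0`.

No definitions. References: A. Beurling, Proc. Nat. Acad. Sci. 41 (1955) (easy half);
N. Nikolski, Ann. Inst. Fourier 45 (1995) 143–159 (distance formulae and localisation of zeros);
L. Báez-Duarte, Rend. Lincei (9) 14 (2003) 5–11, §2.2.
-/

noncomputable section

open Complex MeasureTheory Set Filter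
open scoped Real ENNReal

namespace Summit.RiemannHypothesis.RiemannHypothesis.Theorems

open Summit.RiemannHypothesis.RiemannHypothesis.Theses.NymanBeurling
open Literature.NumberTheory.LFunctions

/-- **Mass of the Cauchy kernel on the critical line.** For `Re ρ > 1/2`,
`∫_ℝ ‖(ρ+1)/((s+1)(s-ρ))‖² dt ≤ π ‖ρ+1‖²/(Re ρ - 1/2)²`, `s = 1/2 + it`
(pointwise `‖s+1‖² ≥ 1+t²` and `‖s-ρ‖ ≥ Re ρ - 1/2`, and `∫ (1+t²)⁻¹ = π`). [folklore] -/
theorem nb_lintegral_kernel_sq_le {ρ : ℂ} (hρ : 1 / 2 < ρ.re) :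
    ∫⁻ t : ℝ, ‖(ρ + 1) / ((1 / 2 : ℂ) + t * I + 1) / (1 / 2 + t * I - ρ)‖ₑ ^ (2 : ℝ) ≤
      ENNReal.ofReal ((‖ρ + 1‖ / (ρ.re - 1 / 2)) ^ 2 * π) := by
  set δ := ρ.re - 1 / 2 with hδ
  have hδ0 : 0 < δ := by rw [hδ]; linarith
  set M : ℝ := (‖ρ + 1‖ / δ) ^ 2 with hM
  have hbound : ∀ t : ℝ, ‖(ρ + 1) / ((1 / 2 : ℂ) + t * I + 1) / (1 / 2 + t * I - ρ)‖ ^ 2 ≤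
      M * (1 + t ^ 2)⁻¹ := by
    intro t
    have h1 : 1 + t ^ 2 ≤ ‖(1 / 2 : ℂ) + t * I + 1‖ ^ 2 := by
      rw [Complex.sq_norm, Complex.normSq_apply]; simp; nlinarith
    have h2 : δ ≤ ‖(1 / 2 : ℂ) + t * I - ρ‖ := by
      have := abs_re_le_norm ((1 / 2 : ℂ) + t * I - ρ)
      have hre : ((1 / 2 : ℂ) + t * I - ρ).re = 1 / 2 - ρ.re := by simp
      rw [hre, abs_sub_comm, abs_of_pos (by rw [hδ] at hδ0; linarith)] at this
      rw [hδ]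
      exact this
    have h2' : δ ^ 2 ≤ ‖(1 / 2 : ℂ) + t * I - ρ‖ ^ 2 := pow_le_pow_left₀ hδ0.le h2 2
    have h1' : 0 < 1 + t ^ 2 := by positivity
    calc ‖(ρ + 1) / ((1 / 2 : ℂ) + t * I + 1) / (1 / 2 + t * I - ρ)‖ ^ 2
        = ‖ρ + 1‖ ^ 2 / (‖(1 / 2 : ℂ) + t * I + 1‖ ^ 2 * ‖(1 / 2 : ℂ) + t * I - ρ‖ ^ 2) := by
          rw [norm_div, norm_div, div_pow, div_pow, div_div]
      _ ≤ ‖ρ + 1‖ ^ 2 / ((1 + t ^ 2) * δ ^ 2) := by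
          refine div_le_div_of_nonneg_left (sq_nonneg _) (by positivity) ?_
          exact mul_le_mul h1 h2' (by positivity) (by positivity)
      _ = M * (1 + t ^ 2)⁻¹ := by
          rw [hM]
          field_simp
  have hint : Integrable fun t : ℝ ↦ M * (1 + t ^ 2)⁻¹ := integrable_inv_one_add_sq.const_mul M
  calc ∫⁻ t : ℝ, ‖(ρ + 1) / ((1 / 2 : ℂ) + t * I + 1) / (1 / 2 + t * I - ρ)‖ₑ ^ (2 : ℝ)
      ≤ ∫⁻ t : ℝ, ENNReal.ofReal (M * (1 + t ^ 2)⁻¹) := by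
        refine lintegral_mono fun t ↦ ?_
        rw [ENNReal.rpow_two, ← ofReal_norm, ← ENNReal.ofReal_pow (norm_nonneg _)]
        exact ENNReal.ofReal_le_ofReal (hbound t)
    _ = ENNReal.ofReal (∫ t : ℝ, M * (1 + t ^ 2)⁻¹) := by
        rw [ofReal_integral_eq_lintegral_ofReal hint]
        exact Eventually.of_forall fun t ↦ by positivity
    _ = ENNReal.ofReal (M * π) := by rw [integral_const_mul, integral_univ_inv_one_add_sq]
    _ = ENNReal.ofReal ((‖ρ + 1‖ / (ρ.re - 1 / 2)) ^ 2 * π) := by rw [hM, hδ]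

/-- **Zero-localisation floor (quantitative easy half of Nyman–Beurling–Báez-Duarte).** If
`ζ(ρ) = 0` with `Re ρ > 1/2`, then for EVERY Dirichlet polynomial `A(s) = Σ_{k<N} a_k (k+1)^{-s}`,
`4π (Re ρ - 1/2)² ‖ρ-1‖² / (‖ρ‖⁴ ‖ρ+1‖²) ≤ ∫_ℝ |1 - ζ(1/2+it) A(1/2+it)|² dt/(1/4+t²)`.
Proof: with `F(s) = (1 - ζ(s)A(s))(s-1)(ρ+1)/((s+1)s²)` (holomorphic on `Re s > 0`,
`F(ρ) = (ρ-1)/ρ²`), the contour inequality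
`Literature.NumberTheory.LFunctions.ofReal_norm_le_lintegral_line` gives
`2π‖F(ρ)‖ ≤ ∫ ‖F(s)‖/‖s-ρ‖ dt ≤ I^{1/2} · (π‖ρ+1‖²/(Re ρ-1/2)²)^{1/2}` by Cauchy–Schwarz and
`nb_lintegral_kernel_sq_le`; square and divide. Unconditional; under RH the hypothesis is void.
[cite: Beurling1955, Theorem (easy half)] [cite: BaezDuarte2003, §2.2] -/
theorem nbIntegrand_floor_of_zero {ρ : ℂ} (hζ : riemannZeta ρ = 0) (hρ : 1 / 2 < ρ.re)
    (N : ℕ) (a : Fin N → ℂ) :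
    ENNReal.ofReal (4 * π * (ρ.re - 1 / 2) ^ 2 * ‖ρ - 1‖ ^ 2 / (‖ρ‖ ^ 4 * ‖ρ + 1‖ ^ 2)) ≤
      ∫⁻ t : ℝ, ENNReal.ofReal (‖1 - riemannZeta (1 / 2 + t * Complex.I) *
        ∑ n : Fin N, a n * ((n : ℂ) + 1) ^ (-(1 / 2 + t * Complex.I))‖ ^ 2 / (1 / 4 + t ^ 2)) := by
  -- elementary facts about `ρ`
  have hρ1 : ρ ≠ 1 := fun h ↦ riemannZeta_one_ne_zero (h ▸ hζ)
  have hρ0 : ρ ≠ 0 := by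
    intro h; rw [h] at hρ; simp at hρ; linarith
  have hρm1 : ρ + 1 ≠ 0 := by
    intro h
    have : (ρ + 1).re = 0 := by rw [h]; simp
    simp at this; linarith
  have hδ0 : 0 < ρ.re - 1 / 2 := by linarith
  have hn1 : 0 < ‖ρ - 1‖ := norm_pos_iff.mpr (sub_ne_zero.mpr hρ1)
  have hn0 : 0 < ‖ρ‖ := norm_pos_iff.mpr hρ0
  have hnm1 : 0 < ‖ρ + 1‖ := norm_pos_iff.mpr hρm1
  -- the two constants
  set v : ℝ := 2 * π * ‖(ρ - 1) / ρ ^ 2‖ with hv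
  have hv' : v = 2 * π * ‖ρ - 1‖ / ‖ρ‖ ^ 2 := by
    rw [hv, norm_div, norm_pow]; ring
  have hv0 : 0 < v := by rw [hv']; positivity
  set K : ℝ := (‖ρ + 1‖ / (ρ.re - 1 / 2)) ^ 2 * π with hK
  have hK0 : 0 < K := by
    have : 0 < ‖ρ + 1‖ / (ρ.re - 1 / 2) := div_pos hnm1 hδ0
    positivity
  -- the target constant is `v² / K`
  have hc : 4 * π * (ρ.re - 1 / 2) ^ 2 * ‖ρ - 1‖ ^ 2 / (‖ρ‖ ^ 4 * ‖ρ + 1‖ ^ 2) = v ^ 2 / K := by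
    rw [hv', hK]
    field_simp
    ring
  -- the integral and the kernel mass
  set Iv : ℝ≥0∞ := ∫⁻ t : ℝ, ENNReal.ofReal (‖1 - riemannZeta (1 / 2 + t * Complex.I) *
      ∑ n : Fin N, a n * ((n : ℂ) + 1) ^ (-(1 / 2 + t * Complex.I))‖ ^ 2 / (1 / 4 + t ^ 2)) with hIv
  set G : ℝ≥0∞ := ∫⁻ t : ℝ, ‖(ρ + 1) / ((1 / 2 : ℂ) + t * I + 1) / (1 / 2 + t * I - ρ)‖ₑ ^ (2 : ℝ)
    with hG
  have hGle : G ≤ ENNReal.ofReal K := nb_lintegral_kernel_sq_le hρ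
  have hg_meas : Measurable fun t : ℝ ↦
      ‖(ρ + 1) / ((1 / 2 : ℂ) + t * I + 1) / (1 / 2 + t * I - ρ)‖ₑ := by
    refine Measurable.enorm ?_
    exact (by fun_prop : Measurable fun t : ℝ ↦
      (ρ + 1) / ((1 / 2 : ℂ) + t * I + 1) / (1 / 2 + t * I - ρ))
  -- Step 1: the contour inequality and Cauchy–Schwarz: `ofReal v ≤ Iv^{1/2} G^{1/2}`
  have key : ENNReal.ofReal v ≤ Iv ^ (1 / 2 : ℝ) * G ^ (1 / 2 : ℝ) := by
    set M := ∑ n : Fin N, ‖a n‖ with hM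
    have hM0 : 0 ≤ M := Finset.sum_nonneg fun n _ ↦ norm_nonneg _
    have hC : 0 ≤ (2 + 5 * M) * ‖ρ + 1‖ := by positivity
    have hcore := ofReal_norm_le_lintegral_line (F := nbAux ρ a) hρ (differentiableOn_nbAux ρ a)
      (R₀ := 1) hC (fun s hs h1 ↦ norm_nbAux_le ρ a hs h1)
    rw [nbAux_apply_self hζ hρ1 hρm1] at hcore
    refine hcore.trans ?_
    set f : ℝ → ℝ≥0∞ := fun t ↦ ENNReal.ofReal
      (‖1 - riemannZeta (1 / 2 + t * I) * dirichletPoly a (1 / 2 + t * I)‖ / ‖(1 / 2 : ℂ) + t * I‖)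
      with hf
    set g : ℝ → ℝ≥0∞ := fun t ↦ ‖(ρ + 1) / ((1 / 2 : ℂ) + t * I + 1) / (1 / 2 + t * I - ρ)‖ₑ
      with hg
    have hf_meas : Measurable f := by
      refine ENNReal.measurable_ofReal.comp ?_
      refine Measurable.div ?_ (by fun_prop)
      refine (Continuous.norm ?_).measurable
      have hc : Continuous fun t : ℝ ↦ (1 / 2 : ℂ) + t * I := by fun_prop
      exact continuous_const.sub (continuous_riemannZeta_line.mul
        ((NymanBeurlingDirichlet.continuous_dirichletPoly a).comp hc))
    calc ∫⁻ t : ℝ, ‖nbAux ρ a (1 / 2 + t * I) / (1 / 2 + t * I - ρ)‖ₑ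
        = ∫⁻ t : ℝ, (f * g) t := lintegral_congr fun t ↦ enorm_nbAux_div_line ρ a t
      _ ≤ (∫⁻ t, f t ^ (2 : ℝ)) ^ (1 / (2 : ℝ)) * (∫⁻ t, g t ^ (2 : ℝ)) ^ (1 / (2 : ℝ)) :=
          ENNReal.lintegral_mul_le_Lp_mul_Lq volume Real.HolderConjugate.two_two
            hf_meas.aemeasurable hg_meas.aemeasurable
      _ = Iv ^ (1 / 2 : ℝ) * G ^ (1 / 2 : ℝ) := by
          congr 2
          refine lintegral_congr fun t ↦ ?_
          rw [hf]
          dsimp only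
          rw [ENNReal.rpow_two, ← ENNReal.ofReal_pow (by positivity), div_pow,
            norm_sq_one_half_add t]
          rfl
  -- Step 2: replace `G` by its bound and pass to real numbers
  have key2 : ENNReal.ofReal v ≤ Iv ^ (1 / 2 : ℝ) * ENNReal.ofReal (Real.sqrt K) := by
    have hGK : G ^ (1 / 2 : ℝ) ≤ ENNReal.ofReal (Real.sqrt K) :=
      calc G ^ (1 / 2 : ℝ) ≤ (ENNReal.ofReal K) ^ (1 / 2 : ℝ) :=
            ENNReal.rpow_le_rpow hGle (by norm_num)
        _ = ENNReal.ofReal (Real.sqrt K) := by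
            rw [ENNReal.ofReal_rpow_of_nonneg hK0.le (by norm_num), Real.sqrt_eq_rpow]
    calc ENNReal.ofReal v ≤ Iv ^ (1 / 2 : ℝ) * G ^ (1 / 2 : ℝ) := key
      _ ≤ Iv ^ (1 / 2 : ℝ) * ENNReal.ofReal (Real.sqrt K) := by gcongr
  rcases eq_or_ne Iv ⊤ with htop | hfin
  · rw [htop]; exact le_top
  set i : ℝ := Iv.toReal with hi
  have hi0 : 0 ≤ i := ENNReal.toReal_nonneg
  have hIi : Iv = ENNReal.ofReal i := (ENNReal.ofReal_toReal hfin).symm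
  have hreal : v ≤ Real.sqrt i * Real.sqrt K := by
    have h := key2
    rw [hIi, ENNReal.ofReal_rpow_of_nonneg hi0 (by norm_num), ← Real.sqrt_eq_rpow,
      ← ENNReal.ofReal_mul (Real.sqrt_nonneg _)] at h
    exact (ENNReal.ofReal_le_ofReal_iff (by positivity)).mp h
  have hsq : v ^ 2 ≤ i * K := by
    have h := pow_le_pow_left₀ hv0.le hreal 2
    have e : (Real.sqrt i * Real.sqrt K) ^ 2 = i * K := by
      rw [mul_pow, Real.sq_sqrt hi0, Real.sq_sqrt hK0.le]
    exact h.trans_eq e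
  rw [hc, hIi]
  refine ENNReal.ofReal_le_ofReal ?_
  rwa [div_le_iff₀ hK0]

/-- **Certificate reading: one distance value constrains every off-line zero.** If some Dirichlet
polynomial achieves `∫ |1 - ζA|²/(1/4+t²) < η`, then every zero `ρ` of `ζ` with `Re ρ > 1/2`
satisfies `4π (Re ρ - 1/2)² ‖ρ-1‖² / (‖ρ‖⁴ ‖ρ+1‖²) < η`. (Zeros with `Re ρ < 1/2` are mirror
images under `s ↦ 1-s`.) Nikolski-type localisation of zeros from a Nyman–Beurling distance.
[cite: Beurling1955, Theorem (easy half)] -/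
theorem nb_zero_constraint_of_witness {N : ℕ} {a : Fin N → ℂ} {η : ℝ}
    (h : ∫⁻ t : ℝ, ENNReal.ofReal (‖1 - riemannZeta (1 / 2 + t * Complex.I) *
        ∑ n : Fin N, a n * ((n : ℂ) + 1) ^ (-(1 / 2 + t * Complex.I))‖ ^ 2 / (1 / 4 + t ^ 2)) <
      ENNReal.ofReal η)
    {ρ : ℂ} (hζ : riemannZeta ρ = 0) (hρ : 1 / 2 < ρ.re) :
    4 * π * (ρ.re - 1 / 2) ^ 2 * ‖ρ - 1‖ ^ 2 / (‖ρ‖ ^ 4 * ‖ρ + 1‖ ^ 2) < η := by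
  have h1 := (nbIntegrand_floor_of_zero hζ hρ N a).trans_lt h
  rcases le_or_gt η 0 with hη | hη
  · rw [ENNReal.ofReal_of_nonpos hη] at h1
    exact absurd h1 ENNReal.not_lt_zero
  · exact (ENNReal.ofReal_lt_ofReal_iff hη).mp h1

/-- **Parabolic zero-free region from a witness.** If some Dirichlet polynomial achieves
`∫ |1 - ζA|²/(1/4+t²) < η`, then every zero `ρ = β + iγ` of `ζ` with `β > 1/2` and `|γ| ≥ 1` has
`π (β - 1/2)² < 5 η γ⁴`; i.e. `ζ ≠ 0` on `{β ≥ 1/2 + √(5η/π) γ², |γ| ≥ 1}`. (From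
`nb_zero_constraint_of_witness` with `‖ρ-1‖² ≥ γ²`, `‖ρ‖² ≤ 2γ²`, `‖ρ+1‖² ≤ 5γ²`, using `β < 1`.)
[cite: Beurling1955, Theorem (easy half)] -/
theorem nb_zero_free_parabola_of_witness {N : ℕ} {a : Fin N → ℂ} {η : ℝ}
    (h : ∫⁻ t : ℝ, ENNReal.ofReal (‖1 - riemannZeta (1 / 2 + t * Complex.I) *
        ∑ n : Fin N, a n * ((n : ℂ) + 1) ^ (-(1 / 2 + t * Complex.I))‖ ^ 2 / (1 / 4 + t ^ 2)) <
      ENNReal.ofReal η)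
    {ρ : ℂ} (hζ : riemannZeta ρ = 0) (hρ : 1 / 2 < ρ.re) (hγ : 1 ≤ |ρ.im|) :
    π * (ρ.re - 1 / 2) ^ 2 < 5 * η * ρ.im ^ 4 := by
  have hc := nb_zero_constraint_of_witness h hζ hρ
  have hβ1 : ρ.re < 1 := by
    by_contra hge
    exact riemannZeta_ne_zero_of_one_le_re (not_lt.mp hge) hζ
  have hγ2 : 1 ≤ ρ.im ^ 2 := by nlinarith [abs_nonneg ρ.im, sq_abs ρ.im]
  have him : 0 < ρ.im ^ 2 := by linarith
  have him4 : 0 < ρ.im ^ 4 := by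
    rw [show ρ.im ^ 4 = (ρ.im ^ 2) ^ 2 by ring]; exact pow_pos him 2
  -- norms in coordinates
  have hn1 : ρ.im ^ 2 ≤ ‖ρ - 1‖ ^ 2 := by
    rw [Complex.sq_norm, Complex.normSq_apply]; simp; nlinarith
  have hn0 : ‖ρ‖ ^ 2 ≤ 2 * ρ.im ^ 2 := by
    rw [Complex.sq_norm, Complex.normSq_apply]; nlinarith
  have hnm1 : ‖ρ + 1‖ ^ 2 ≤ 5 * ρ.im ^ 2 := by
    rw [Complex.sq_norm, Complex.normSq_apply]; simp; nlinarith
  have hρ0 : 0 < ‖ρ‖ := by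
    refine norm_pos_iff.mpr ?_
    intro h0; rw [h0] at hρ; simp at hρ; linarith
  have hρm1 : 0 < ‖ρ + 1‖ := by
    refine norm_pos_iff.mpr ?_
    intro h0
    have : (ρ + 1).re = 0 := by rw [h0]; simp
    simp at this; linarith
  have hden : 0 < ‖ρ‖ ^ 4 * ‖ρ + 1‖ ^ 2 := by positivity
  have hδ : 0 < (ρ.re - 1 / 2) ^ 2 := by
    have : 0 < ρ.re - 1 / 2 := by linarith
    positivity
  -- `c(ρ) ≥ π (β-1/2)² / (5 γ⁴)`
  have hlow : π * (ρ.re - 1 / 2) ^ 2 / (5 * ρ.im ^ 4) ≤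
      4 * π * (ρ.re - 1 / 2) ^ 2 * ‖ρ - 1‖ ^ 2 / (‖ρ‖ ^ 4 * ‖ρ + 1‖ ^ 2) := by
    rw [div_le_div_iff₀ (by positivity) hden]
    have h4 : ‖ρ‖ ^ 4 ≤ 4 * ρ.im ^ 4 := by
      have := pow_le_pow_left₀ (sq_nonneg _) hn0 2
      nlinarith [this]
    have hA : ‖ρ‖ ^ 4 * ‖ρ + 1‖ ^ 2 ≤ 20 * ρ.im ^ 4 * ρ.im ^ 2 := by
      calc ‖ρ‖ ^ 4 * ‖ρ + 1‖ ^ 2 ≤ (4 * ρ.im ^ 4) * (5 * ρ.im ^ 2) :=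
            mul_le_mul h4 hnm1 (by positivity) (by positivity)
        _ = 20 * ρ.im ^ 4 * ρ.im ^ 2 := by ring
    calc π * (ρ.re - 1 / 2) ^ 2 * (‖ρ‖ ^ 4 * ‖ρ + 1‖ ^ 2)
        ≤ π * (ρ.re - 1 / 2) ^ 2 * (20 * ρ.im ^ 4 * ρ.im ^ 2) := by gcongr
      _ = 4 * π * (ρ.re - 1 / 2) ^ 2 * ρ.im ^ 2 * (5 * ρ.im ^ 4) := by ring
      _ ≤ 4 * π * (ρ.re - 1 / 2) ^ 2 * ‖ρ - 1‖ ^ 2 * (5 * ρ.im ^ 4) := by gcongr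
  have hlt := hlow.trans_lt hc
  rw [div_lt_iff₀ (by positivity)] at hlt
  linarith

/-- **Failure of RH puts a uniform positive floor under all distances** (kill criterion (i) of the
route read backwards: a zero off the line is detected by EVERY `d_N`, with one constant).
[cite: Beurling1955, Theorem (easy half)] -/
theorem nb_uniform_floor_of_not_riemannHypothesis (h : ¬ _root_.RiemannHypothesis) :
    ∃ c : ℝ, 0 < c ∧ ∀ (N : ℕ) (a : Fin N → ℂ), ENNReal.ofReal c ≤
      ∫⁻ t : ℝ, ENNReal.ofReal (‖1 - riemannZeta (1 / 2 + t * Complex.I) *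
        ∑ n : Fin N, a n * ((n : ℂ) + 1) ^ (-(1 / 2 + t * Complex.I))‖ ^ 2 / (1 / 4 + t ^ 2)) := by
  -- a zero with `1/2 < Re ρ < 1` exists
  have hq : ¬ QuasiRiemannHypothesis (1 / 2) :=
    fun hq ↦ h (quasiRiemannHypothesis_one_half_iff_holds.mp hq)
  unfold QuasiRiemannHypothesis at hq
  push Not at hq
  obtain ⟨ρ, hζ, hρ, -⟩ := hq
  have hρ1 : ρ ≠ 1 := fun h1 ↦ riemannZeta_one_ne_zero (h1 ▸ hζ)
  have hρ0 : ρ ≠ 0 := by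
    intro h0; rw [h0] at hρ; simp at hρ; linarith
  have hρm1 : ρ + 1 ≠ 0 := by
    intro h0
    have : (ρ + 1).re = 0 := by rw [h0]; simp
    simp at this; linarith
  have hn1 : 0 < ‖ρ - 1‖ := norm_pos_iff.mpr (sub_ne_zero.mpr hρ1)
  have hn0 : 0 < ‖ρ‖ := norm_pos_iff.mpr hρ0
  have hnm1 : 0 < ‖ρ + 1‖ := norm_pos_iff.mpr hρm1
  have hδ0 : 0 < ρ.re - 1 / 2 := by linarith
  refine ⟨4 * π * (ρ.re - 1 / 2) ^ 2 * ‖ρ - 1‖ ^ 2 / (‖ρ‖ ^ 4 * ‖ρ + 1‖ ^ 2), by positivity,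
    fun N a ↦ nbIntegrand_floor_of_zero hζ hρ N a⟩

/-- **Dichotomy.** The thesis `NbThesis` fails iff one positive constant lies below every distance
integral. (`→`: `NbThesis ↔ RH` (`nbThesis_iff_riemannHypothesis`) and the uniform floor under
`¬RH`; `←`: a floor `c` contradicts the `ε = c` clause of the thesis.) [folklore] -/
theorem not_nbThesis_iff_uniform_floor :
    ¬ NbThesis ↔ ∃ c : ℝ, 0 < c ∧ ∀ (N : ℕ) (a : Fin N → ℂ), ENNReal.ofReal c ≤
      ∫⁻ t : ℝ, ENNReal.ofReal (‖1 - riemannZeta (1 / 2 + t * Complex.I) *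
        ∑ n : Fin N, a n * ((n : ℂ) + 1) ^ (-(1 / 2 + t * Complex.I))‖ ^ 2 / (1 / 4 + t ^ 2)) := by
  constructor
  · intro h
    exact nb_uniform_floor_of_not_riemannHypothesis fun hRH ↦ h (nbThesis_iff_riemannHypothesis.mpr hRH)
  · rintro ⟨c, hc, hfloor⟩ hX
    obtain ⟨N, a, ha⟩ := hX c hc
    exact absurd (lt_of_le_of_lt (hfloor N a) ha) (lt_irrefl _)

/-- **`⨅` form of the thesis.** `NbThesis` holds iff the infimum over all Dirichlet polynomials (all
lengths, all coefficients) of the distance integral is `0` in `ℝ≥0∞`. [folklore] -/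
theorem nbThesis_iff_iInf_eq_zero :
    NbThesis ↔ (⨅ N : ℕ, ⨅ a : Fin N → ℂ,
      ∫⁻ t : ℝ, ENNReal.ofReal (‖1 - riemannZeta (1 / 2 + t * Complex.I) *
        ∑ n : Fin N, a n * ((n : ℂ) + 1) ^ (-(1 / 2 + t * Complex.I))‖ ^ 2 / (1 / 4 + t ^ 2))) = 0 := by
  unfold NbThesis
  set m : ℝ≥0∞ := ⨅ N : ℕ, ⨅ a : Fin N → ℂ,
      ∫⁻ t : ℝ, ENNReal.ofReal (‖1 - riemannZeta (1 / 2 + t * Complex.I) *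
        ∑ n : Fin N, a n * ((n : ℂ) + 1) ^ (-(1 / 2 + t * Complex.I))‖ ^ 2 / (1 / 4 + t ^ 2)) with hm
  have hmle : ∀ (N : ℕ) (a : Fin N → ℂ), m ≤
      ∫⁻ t : ℝ, ENNReal.ofReal (‖1 - riemannZeta (1 / 2 + t * Complex.I) *
        ∑ n : Fin N, a n * ((n : ℂ) + 1) ^ (-(1 / 2 + t * Complex.I))‖ ^ 2 / (1 / 4 + t ^ 2)) :=
    fun N a ↦ iInf_le_of_le N (iInf_le _ a)
  constructor
  · intro h
    by_contra hne
    have hpos : 0 < m := pos_iff_ne_zero.mpr hne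
    rcases eq_or_ne m ⊤ with htop | hfin
    · obtain ⟨N, a, ha⟩ := h 1 one_pos
      have h1 := (hmle N a).trans_lt ha
      rw [htop] at h1
      exact absurd h1 not_top_lt
    · have hm' : 0 < m.toReal := ENNReal.toReal_pos hpos.ne' hfin
      obtain ⟨N, a, ha⟩ := h m.toReal hm'
      rw [ENNReal.ofReal_toReal hfin] at ha
      exact absurd (hmle N a) (not_le.mpr ha)
  · intro h ε hε
    have hpos : m < ENNReal.ofReal ε := by
      rw [h]; exact ENNReal.ofReal_pos.mpr hε
    obtain ⟨N, hN⟩ := iInf_lt_iff.mp hpos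
    obtain ⟨a, ha⟩ := iInf_lt_iff.mp hN
    exact ⟨N, a, ha⟩

end Summit.RiemannHypothesis.RiemannHypothesis.Theorems

end
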